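import Summits.HodgeConjecture.HodgeConjecture.Theorems.F0P3cStCharTSShellOrbitalGCan       -- ★ p850004 (LH2-p03) `cmDatumLocalCongr_one_apply` (`e₁ = id`); brings ★ `formCongr_one_qsForm`
import Literature.NumberTheory.Rogawski1990.FinExplicitTransferFactorConjLeft             -- ★ `finTau_conj` (`τ_v` is a class function on `H_v`)
import Literature.NumberTheory.Rogawski1990.EndoscopicEmbedding                           -- ★ `endoEmbLocal` (a hom `H_v →* G_v`)
import HarnessLib

/-!
# F0 · P3c · line LH6 «StCharTS» — road (D) «DEEP-FL», (D-c) head glue «KAPPA-RATIO»: the two letter identifications `κ_{H,u} = A_u · r_H`, `κ_G κ = A_G · r_G`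
# of ★ CJ-BLOCK p850160 in CLOSED FORM, the two measure identities behind them, and the Weyl-flip one-liners for the VALUE slots
# [Rogawski1990, §4.9 (4.9.4) p. 56; §12.7 L. 12.7.3 (proof) p. 195] [Casselman1995, Thm. 5.2 ∕ L. 7.1.1]

Cell `pub/hodgecm-mathlib`, crux H413 = `stmt-HodgeConjecture-24833` (lane `--supports … --as helper`), route HCCMUnconditional; seat LH6-p02 (g2); road (D) owner
LH6-p04 (g3), deal 2026-09-02T07:27:54Z «KAPPA-RATIO★»; constants sheet `F0/P3b/LH6-p02/g2/KAPPA-RATIO.sheet.v1.md` (c7274337).  THEOREMS ONLY, sorry-free, ★-only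
imports; no definition ∕ instance ∕ notation ∕ named fact.  HONEST LABEL: HC_CM is proved only modulo the 7 printed citations (2 remaining: hLiu418 =
stmt-HodgeConjecture-24832, h413 = stmt-HodgeConjecture-24833) until rung 0 closes; count-neutral head glue — closes nothing by itself.

THE LETTERS (★ CJ-BLOCK `exists_cj_finTau_both (F) (κG κ AG rG rH) (κH A) (hκH) (hAH : ∀ u ∈ F, κH u = A u * rH) (hAG : κG * κ = AG * rG)`).  With `νHv = ν₂ ⊗ ν₁`
(★ HAAR-PROD-SPLIT p850050) and at the H-DOMINANT flips `b_u := w₀ u.1 w₀⁻¹` of the oriented reps (sheet §0: the Steinberg exponent sits at the dominant point, ★ p849965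
gives `Tr πSt(𝟙_{K_H u K_H}) = A_u · χ_{H,2}(b_u) · ψdet(u.2)`):
  `A_u  = ν₂(K₂)·#R₂(u)·ν₁(K₁)·δ_{B₂}^{1∕2}(b_u)`                                  (trace constant, ★ p849965),
  `κ_{H,u} = νHv(K₂ × univ)·#R₂(u)·δ_{B₂}^{1∕2}(b_u)·μT₂{K_{2,v}-units}∕μT₂(C₂)`    (orbital constant, ② HOH-SHELL-H after ★ HOH-FLIP, second-coset coefficient 1),
  `κ_G  = (ν_G(K_n)·#R·δ_B^{1∕2}(z aᵐ))·μT₃{K_{3,v}-units}∕μT₃(S_n)`, `κ = 1`          (★ HOG-OF-GVALUE p850178),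
  `A_G  = ν_Q(K_n)·#R·δ_B^{1∕2}(z aᵐ)`                                              (XIG-St RHS prefix),
so **`r_H := ν₁(univ)·μT₂{K_{2,v}-units} ∕ (ν₁(K₁)·μT₂(C₂))`** and **`r_G := μT₃{K_{3,v}-units} ∕ μT₃(S_n)`** make `hAH`, `hAG` identities of (commutative) algebra once
`νHv(K₂ × univ) = ν₂(K₂)·ν₁(univ)` (§2, product measure) and `ν_G(K_n) = ν_Q(K_n)` (§2: `e₁ = id`, ★ `cmDatumLocalCongr_one_apply`).  §1 states both at the head's letters
over OPAQUE per-`u` tokens (so the final ★ text of ② plugs by `rfl`∕`ring`); §3 gives the flip one-liners used to key the VALUE third at `b_u`: `finTau` is a class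
function (★ `finTau_conj`) so CJ-BLOCK's `τ_u = finTau(u)` serves at the flip, `Ψ` is a hom so `Ψ(u♭) = Ψ(w₀,1)·Ψ(u)·Ψ(w₀,1)⁻¹`, and translates transport under conjugation.

* §1 `hAH_of_closed_forms` (+ `_mul_one` for ②'s literal `κ₂ = 1`), `hAG_of_closed_forms` (+ `'` in ★ p850178's parenthesisation) — pure algebra, head's letters.
* §2 `measureReal_prod_prod'` (`(μ.prod ν).real (s ×ˢ t) = μ.real s * ν.real t`), `measureReal_prod_coe_prod` (`↑(K₂.prod K₁)`, both boxes of ★ p850219),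
  `measureReal_prod_coe_prod_top`, `preimage_cmDatumLocalCongr_one_symm`, `map_cmDatumLocalCongr_one_symm_apply`, `map_cmDatumLocalCongr_one_symm_real`.
* §3 `prod_conj_mk_one`, `finTau_weylFlip`, `endoEmbLocal_weylFlip`, `conj_mem_smul_of_mem_conj_smul` (generic translate transport).

## References
* [Rogawski1990] J. D. Rogawski, *Automorphic Representations of Unitary Groups in Three Variables*, Ann. of Math. Stud. 123 (1990): §4.9 Lemma 4.9.2, (4.9.4) p. 56;
  §12.1 case (1) pp. 171–172; §12.7 Lemma 12.7.3 (proof) p. 195.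
* [Casselman1995] W. Casselman, *Introduction to the theory of admissible representations of p-adic reductive groups* (1995), Thm. 5.2, Lemma 7.1.1.
-/

set_option autoImplicit false
-- the mandated namespace has the single-problem summit's repeated segment (`HodgeConjecture.HodgeConjecture`)
set_option linter.dupNamespace false

noncomputable section

open NumberField IsDedekindDomain MeasureTheory Topology
open scoped Matrix MatrixGroups Pointwise ENNReal
open Literature.NumberTheory Literature.NumberTheory.Automorphic Literature.NumberTheory.Automorphic.UnitaryGroup
open Literature.NumberTheory.GaloisRepresentations
open Literature.NumberTheory.Rogawski1990

namespace Summit.HodgeConjecture.HodgeConjecture.Cruxes.H413.F0P3cStCharTSKappaRatio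

/-! ## §1 The two letter identifications at the head's letters (pure algebra) -/

/-- **`hAH` in closed form.**  With `A_u = N₂·Rc_u·N₁K·δ_u` (trace: `N₂ = ν₂(K₂)`, `N₁K = ν₁(K₁)`), `κ_{H,u} = NK·Rc_u·δ_u·V₂∕m₂` (orbital: `NK = νHv(K₂ × univ)`,
`V₂ = μT₂{units}`, `m₂ = μT₂(C₂)`) and `NK = N₂·N₁u` (`N₁u = ν₁(univ)`): `κ_{H,u} = A_u · r_H` for the `u`-FREE `r_H := N₁u·V₂ ∕ (N₁K·m₂)`.
[cite: Rogawski1990, §12.7 Lemma 12.7.3 (proof) p. 195] -/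
theorem hAH_of_closed_forms {ι : Type*} (F : Finset ι) (A κH Rc δ : ι → ℂ) (N2 N1K N1u NK V₂ m₂ : ℂ)
    (hNK : NK = N2 * N1u) (hA : ∀ u ∈ F, A u = N2 * Rc u * N1K * δ u) (hκH : ∀ u ∈ F, κH u = NK * Rc u * δ u * V₂ / m₂)
    (hN1K : N1K ≠ 0) (hm₂ : m₂ ≠ 0) :
    ∀ u ∈ F, κH u = A u * (N1u * V₂ / (N1K * m₂)) := by
  intro u hu
  rw [hκH u hu, hA u hu, hNK]
  field_simp

/-- The same with ★ HOH-FLIP's letter `κ_{H,u} := A₂(u) · κ₂(u)` and ②'s literal second-coset coefficient `κ₂(u) = 1` (★ p850219).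
[cite: Rogawski1990, §12.7 Lemma 12.7.3 (proof) p. 195] -/
theorem hAH_of_closed_forms_mul_one {ι : Type*} (F : Finset ι) (A κH Rc δ : ι → ℂ) (N2 N1K N1u NK V₂ m₂ : ℂ)
    (hNK : NK = N2 * N1u) (hA : ∀ u ∈ F, A u = N2 * Rc u * N1K * δ u) (hκH : ∀ u ∈ F, κH u = NK * Rc u * δ u * V₂ / m₂ * 1)
    (hN1K : N1K ≠ 0) (hm₂ : m₂ ≠ 0) :
    ∀ u ∈ F, κH u = A u * (N1u * V₂ / (N1K * m₂)) :=
  hAH_of_closed_forms F A κH Rc δ N2 N1K N1u NK V₂ m₂ hNK hA (fun u hu => by rw [hκH u hu, mul_one]) hN1K hm₂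

/-- **`hAG` in closed form.**  With `κ_G = (N_G·Rc·δ)·V₃∕m₃` (★ p850178), `κ = 1`, `A_G = N_Q·Rc·δ` (XIG-St) and `N_G = N_Q` (§2): `κ_G·κ = A_G·r_G` for
`r_G := V₃∕m₃`. [cite: Rogawski1990, §12.7 Lemma 12.7.3 (proof) p. 195] -/
theorem hAG_of_closed_forms (NG NQ Rc δ V₃ m₃ : ℂ) (hN : NG = NQ) :
    NG * Rc * δ * V₃ / m₃ * 1 = NQ * Rc * δ * (V₃ / m₃) := by
  rw [hN, mul_one, mul_div_assoc]

/-- The same with `κ_G`'s parenthesisation as printed in ★ p850178 (`((N·R·δ) * V) ∕ m`). [cite: Rogawski1990, §12.7 Lemma 12.7.3 (proof) p. 195] -/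
theorem hAG_of_closed_forms' (NG NQ Rc δ V₃ m₃ : ℂ) (hN : NG = NQ) :
    (NG * Rc * δ) * V₃ / m₃ * 1 = NQ * Rc * δ * (V₃ / m₃) := by
  rw [hN, mul_one, mul_div_assoc]

/-! ## §2 The two measure identities -/

section Measures

/-- `(μ ⊗ ν)(s × t) = μ(s)·ν(t)` in `ℝ` (Mathlib `Measure.prod_prod` through `toReal`). [cite: Rogawski1990, §12.7 Lemma 12.7.3 (proof) p. 195] -/
theorem measureReal_prod_prod' {α β : Type*} [MeasurableSpace α] [MeasurableSpace β] (μ : Measure α) (ν : Measure β) [SFinite ν] (s : Set α) (t : Set β) :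
    (μ.prod ν).real (s ×ˢ t) = μ.real s * ν.real t := by
  rw [measureReal_def, Measure.prod_prod, ENNReal.toReal_mul, ← measureReal_def, ← measureReal_def]

/-- **The box letter of ②**: `(ν₂ ⊗ ν₁)(K₂ × K₁) = ν₂(K₂)·ν₁(K₁)` for SUBGROUPS (`↑(K₂.prod K₁) = ↑K₂ ×ˢ ↑K₁`, Mathlib `Subgroup.coe_prod`) — at `K₁ := K₁` it is the
trace-side box of ★ p850219's `hF1Hg`, at `K₁ := ⊤` (`↑⊤ = univ`) the orbital-side box `νHv(K₂ × univ)`. [cite: Rogawski1990, §12.7 Lemma 12.7.3 (proof) p. 195] -/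
theorem measureReal_prod_coe_prod {G₁ G₂ : Type*} [Group G₁] [Group G₂] [MeasurableSpace G₁] [MeasurableSpace G₂] (μ : Measure G₁) (ν : Measure G₂) [SFinite ν]
    (K₂ : Subgroup G₁) (K₁ : Subgroup G₂) :
    (μ.prod ν).real ((K₂.prod K₁ : Subgroup (G₁ × G₂)) : Set (G₁ × G₂)) = μ.real (K₂ : Set G₁) * ν.real (K₁ : Set G₂) := by
  rw [Subgroup.coe_prod, measureReal_prod_prod']

/-- `(ν₂ ⊗ ν₁)(K₂ × ⊤) = ν₂(K₂)·ν₁(univ)` — the letter `NK = N₂·N₁u` of `hAH_of_closed_forms`. [cite: Rogawski1990, §12.7 Lemma 12.7.3 (proof) p. 195] -/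
theorem measureReal_prod_coe_prod_top {G₁ G₂ : Type*} [Group G₁] [Group G₂] [MeasurableSpace G₁] [MeasurableSpace G₂] (μ : Measure G₁) (ν : Measure G₂) [SFinite ν]
    (K₂ : Subgroup G₁) :
    (μ.prod ν).real ((K₂.prod (⊤ : Subgroup G₂) : Subgroup (G₁ × G₂)) : Set (G₁ × G₂)) = μ.real (K₂ : Set G₁) * ν.real (Set.univ : Set G₂) := by
  rw [measureReal_prod_coe_prod, Subgroup.coe_top]

variable (L : Type) [Field L] [NumberField L] [IsCMField L] (v : HeightOneSpectrum (𝓞 ↥(maximalRealSubfield L)))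

/-- `e₁⁻¹ = id` pointwise on `U(Φ₃)(L⁺_v)` for the identity frame `e₁ = cmDatumLocalCongr L v 1 isUnit_one formCongr_one_qsForm` (★ `cmDatumLocalCongr_one_apply`), as a preimage
statement: `e₁⁻¹ ⁻¹' S = S`. [cite: Rogawski1990, §4.9 p. 55] -/
theorem preimage_cmDatumLocalCongr_one_symm (S : Set ↥(unitaryGroupOfForm (conjLocal L (IsCMField.complexConj L) v) (cmLocalForm L 3 v))) :
    (cmDatumLocalCongr L v (1 : GL (Fin 3) (UnitaryGroup.LocalRing L v)) isUnit_one (F0P3cStCharTSDeltaAtLevi.formCongr_one_qsForm L v)).symm ⁻¹' S =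
      (S : Set ((cmDatum L 3 (qsForm L)).Local v)) := by
  ext x
  rw [Set.mem_preimage]
  have hx : (cmDatumLocalCongr L v (1 : GL (Fin 3) (UnitaryGroup.LocalRing L v)) isUnit_one (F0P3cStCharTSDeltaAtLevi.formCongr_one_qsForm L v)).symm x = x :=
    (ContinuousMulEquiv.symm_apply_eq _).2 (F0P3cStCharTSShellOrbitalG.cmDatumLocalCongr_one_apply L v x).symm
  rw [hx]

/-- **`(ν_G ∘ e₁⁻¹)(S) = ν_G(S)`**: pushing a measure on `U(Φ₃)(L⁺_v) = (cmDatum L 3 (qsForm L)).Local v` along the identity frame `e₁⁻¹` to the matrix carrier (the measure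
letter of ★ p850178's `κ_G`) does not change the mass of a measurable set — so `κ_G`'s `(νG.map e₁.symm).real (K_n)` IS XIG-St's `νQv.real (K_n)` when the head takes
`νG := νQv`. [cite: Rogawski1990, §4.9 p. 55; §12.7 Lemma 12.7.3 (proof) p. 195] -/
theorem map_cmDatumLocalCongr_one_symm_apply
    [MeasurableSpace ((cmDatum L 3 (qsForm L)).Local v)] [BorelSpace ((cmDatum L 3 (qsForm L)).Local v)]
    [MeasurableSpace ↥(unitaryGroupOfForm (conjLocal L (IsCMField.complexConj L) v) (cmLocalForm L 3 v))]
    [BorelSpace ↥(unitaryGroupOfForm (conjLocal L (IsCMField.complexConj L) v) (cmLocalForm L 3 v))]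
    (ν : Measure ((cmDatum L 3 (qsForm L)).Local v))
    (S : Set ↥(unitaryGroupOfForm (conjLocal L (IsCMField.complexConj L) v) (cmLocalForm L 3 v))) (hS : MeasurableSet S) :
    (ν.map (cmDatumLocalCongr L v (1 : GL (Fin 3) (UnitaryGroup.LocalRing L v)) isUnit_one (F0P3cStCharTSDeltaAtLevi.formCongr_one_qsForm L v)).symm :
        Measure ↥(unitaryGroupOfForm (conjLocal L (IsCMField.complexConj L) v) (cmLocalForm L 3 v))) S =
      ν (S : Set ((cmDatum L 3 (qsForm L)).Local v)) := by
  have hc : @Continuous ((cmDatum L 3 (qsForm L)).Local v) ↥(unitaryGroupOfForm (conjLocal L (IsCMField.complexConj L) v) (cmLocalForm L 3 v)) _ _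
      ⇑((cmDatumLocalCongr L v (1 : GL (Fin 3) (UnitaryGroup.LocalRing L v)) isUnit_one
      (F0P3cStCharTSDeltaAtLevi.formCongr_one_qsForm L v)).symm) :=
    (cmDatumLocalCongr L v (1 : GL (Fin 3) (UnitaryGroup.LocalRing L v)) isUnit_one
      (F0P3cStCharTSDeltaAtLevi.formCongr_one_qsForm L v)).symm.continuous
  have hm : @Measurable ((cmDatum L 3 (qsForm L)).Local v) ↥(unitaryGroupOfForm (conjLocal L (IsCMField.complexConj L) v) (cmLocalForm L 3 v)) _ _
      ⇑((cmDatumLocalCongr L v (1 : GL (Fin 3) (UnitaryGroup.LocalRing L v)) isUnit_one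
      (F0P3cStCharTSDeltaAtLevi.formCongr_one_qsForm L v)).symm) := hc.measurable
  rw [Measure.map_apply hm hS]
  exact congrArg (fun T : Set ((cmDatum L 3 (qsForm L)).Local v) => ν T) (preimage_cmDatumLocalCongr_one_symm L v S)

/-- The `.real` form of `map_cmDatumLocalCongr_one_symm_apply` (the letter `N_G = N_Q` of `hAG_of_closed_forms`). [cite: Rogawski1990, §12.7 Lemma 12.7.3 (proof) p. 195] -/
theorem map_cmDatumLocalCongr_one_symm_real
    [MeasurableSpace ((cmDatum L 3 (qsForm L)).Local v)] [BorelSpace ((cmDatum L 3 (qsForm L)).Local v)]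
    [MeasurableSpace ↥(unitaryGroupOfForm (conjLocal L (IsCMField.complexConj L) v) (cmLocalForm L 3 v))]
    [BorelSpace ↥(unitaryGroupOfForm (conjLocal L (IsCMField.complexConj L) v) (cmLocalForm L 3 v))]
    (ν : Measure ((cmDatum L 3 (qsForm L)).Local v))
    (S : Set ↥(unitaryGroupOfForm (conjLocal L (IsCMField.complexConj L) v) (cmLocalForm L 3 v))) (hS : MeasurableSet S) :
    (ν.map (cmDatumLocalCongr L v (1 : GL (Fin 3) (UnitaryGroup.LocalRing L v)) isUnit_one (F0P3cStCharTSDeltaAtLevi.formCongr_one_qsForm L v)).symm :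
        Measure ↥(unitaryGroupOfForm (conjLocal L (IsCMField.complexConj L) v) (cmLocalForm L 3 v))).real S =
      ν.real (S : Set ((cmDatum L 3 (qsForm L)).Local v)) := by
  rw [measureReal_def, measureReal_def, map_cmDatumLocalCongr_one_symm_apply L v ν S hS]

end Measures

/-! ## §3 The Weyl-flip one-liners for the VALUE slots at the dominant reps -/

section Flip

variable (L : Type) [Field L] [NumberField L] [IsCMField L] (v : HeightOneSpectrum (𝓞 ↥(maximalRealSubfield L)))

/-- `(w₀ h w₀⁻¹, z) = (w₀, 1)·(h, z)·(w₀, 1)⁻¹` in `H_v = U(Φ₂)_v × U(Φ₁)_v`. [folklore] -/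
theorem prod_conj_mk_one {A B : Type*} [Group A] [Group B] (w₀ h : A) (z : B) :
    ((w₀ * h * w₀⁻¹, z) : A × B) = (w₀, 1) * (h, z) * (w₀, 1)⁻¹ := by
  rw [Prod.inv_mk, inv_one, Prod.mk_mul_mk, Prod.mk_mul_mk, one_mul, mul_one]

/-- **`τ_v` at the flip**: `finTau(w₀ h w₀⁻¹, z) = finTau(h, z)` (★ `finTau_conj`: `τ_v` is a class function on `H_v`), so ★ CJ-BLOCK's `τ u := finTau L v (↑u.1, u.2) μ`
serves as the `hτ` input of ★ p850018 at the DOMINANT rep `(w₀ ↑u.1 w₀⁻¹, u.2)`. [cite: Rogawski1990, §4.9 p. 55] -/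
theorem finTau_weylFlip (μ : HeckeCharacter L)
    (w₀ h : (cmDatum L 2 (Matrix.of fun i j : Fin 2 => if i.val + j.val + 1 = 2 then (1 : L) else 0)).Local v)
    (z : (cmDatum L 1 (Matrix.of fun i j : Fin 1 => if i.val + j.val + 1 = 1 then (1 : L) else 0)).Local v) :
    finTau L v (w₀ * h * w₀⁻¹, z) μ = finTau L v (h, z) μ := by
  rw [prod_conj_mk_one]
  exact finTau_conj L v (a := (h, z)) (x := (w₀, 1)) μ

/-- **`Ψ` at the flip**: `Ψ(w₀ h w₀⁻¹, z) = Ψ(w₀,1)·Ψ(h,z)·Ψ(w₀,1)⁻¹` (`Ψ = endoEmbLocal L v` is a hom). [cite: Rogawski1990, §4.9 p. 55] -/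
theorem endoEmbLocal_weylFlip
    (w₀ h : (cmDatum L 2 (Matrix.of fun i j : Fin 2 => if i.val + j.val + 1 = 2 then (1 : L) else 0)).Local v)
    (z : (cmDatum L 1 (Matrix.of fun i j : Fin 1 => if i.val + j.val + 1 = 1 then (1 : L) else 0)).Local v) :
    endoEmbLocal L v (w₀ * h * w₀⁻¹, z) = endoEmbLocal L v (w₀, 1) * endoEmbLocal L v (h, z) * (endoEmbLocal L v (w₀, 1))⁻¹ := by
  rw [prod_conj_mk_one, map_mul, map_mul, map_inv]

/-- **Translates under conjugation** (generic): if `t′ ∈ (w b w⁻¹) • S` and `S` is stable under `s ↦ w⁻¹ s w`, then `w⁻¹ t′ w ∈ b • S` — the transport of the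
reps-on-shell conjunct of ★ COSET-COVER ∕ ★ XIG-DATA from the flipped base `b′ = w b w⁻¹` to `b`. [cite: Rogawski1990, §12.7 Lemma 12.7.3 (proof) p. 195] -/
theorem conj_mem_smul_of_mem_conj_smul {G : Type*} [Group G] {S : Set G} {w b t' : G} (ht' : t' ∈ (w * b * w⁻¹) • S)
    (hS : ∀ s ∈ S, w⁻¹ * s * w ∈ S) : w⁻¹ * t' * w ∈ b • S := by
  obtain ⟨s, hs, rfl⟩ := Set.mem_smul_set.1 ht'
  refine Set.mem_smul_set.2 ⟨w⁻¹ * s * w, hS s hs, ?_⟩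
  simp only [smul_eq_mul]
  group

end Flip

end Summit.HodgeConjecture.HodgeConjecture.Cruxes.H413.F0P3cStCharTSKappaRatio

end
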